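import Mathlib
import Summits.Ventures.HodgeRepro.Tier4.Target
import Summits.Ventures.HodgeRepro.Tier4.Line3.Defs
import Summits.Ventures.HodgeRepro.Tier4.Line3.LocaliserS
import Summits.Ventures.HodgeRepro.Tier4.Line3.InvariantDensityTransfer
import Summits.Ventures.HodgeRepro.Tier4.Line3.OffMainInvariance
import Summits.Ventures.HodgeRepro.Tier4.Line3.TermDominatedAssembly
import Summits.Ventures.HodgeRepro.Tier4.Line3.InvariantMajorantGlue
import Summits.Ventures.HodgeRepro.Tier4.Line3.InvariantMajorantDef
import Summits.Ventures.HodgeRepro.Tier4.Line3.InvariantClassBound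

/-!
# Tier4/Line3/InvariantRouteAssembly — L3.5 through the `Γ`-invariant majorant: the residual, displayed

Blind re-derivation cell `pub-hodge-repro`, Tier 4 «PROVE THE STEP» (README §9–§10), LINE L3, seat t4-L2-p3 (gen 2,
on L3.5 `term_dominated`).  This module composes the invariant-majorant route (S12951) to the residual `OffMainMass`
of L3.5 and to L3.5 itself:

* `offMainDensity_le_invMajorantDensity` — THE POINTWISE BOUND: under the invariant growth clause `GrowthInv` and for
  a set `S′` of line tuples containing the support of the localiser (`SupportIn`), the off-main density of the depth-`N`
  localiser is at most `K q₂^N e^{−κ q^{N/d}}` times the invariant majorant density `invMajorantDensity D S′ xm e c₁`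
  (termwise from `InvariantClassBound.summand_bound_off_main_inv`; the summand vanishes off the support);
* `offMainMass_of_growthInv` — `OffMainMass` from `GrowthInv`, a `Γ`-STABLE `S′` containing the support, a
  fundamental domain `F` of `Γ` and the FINITE MASS of the invariant majorant density over `F`
  (the glue `InvariantMajorantGlue.offMainMass_of_invariantMajorant` with `μ = invMajorantDensity`, invariant by
  `InvariantMajorantDef.invMajorantDensity_isInvariant`);
* `term_dominated_of_growthInv` — L3.5's conclusion VERBATIM from the same hypotheses
  (`TermDominatedAssembly.term_dominated_of_offMainMass`).

So L3.5 = [this composition] ∘ {`GrowthInv` (the interface clause of the localiser, S12951 (3)); `IsGammaStable S′ ∧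
SupportIn S′` (a `Γ`-stable lattice containing the support lattices — rung (I2)); the theta mass of the invariant
majorant over the compact fundamental domain `F` (rung (I4)); `hlit` (the fundamental domain `F`)} — NO good domain of
the level and NO archimedean size of coset representatives anywhere.  No printed input enters this module.  Nothing
here asserts anything about the truth of (P); HC_CM is NOT proved by anyone in this repository.
-/

set_option autoImplicit false

noncomputable section

namespace Summit.Ventures.HodgeRepro.Tier4.Line3

open Summit.Ventures.HodgeRepro.Tier4
open MeasureTheory NumberField
open scoped ENNReal

namespace T4Data

variable (X : T4Data)

/-- The support of the localiser (the line tuples with a non-zero coefficient at some depth) lies in `S'`. -/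
def SupportIn (D : X.ThetaData) (p : IsDedekindDomain.HeightOneSpectrum (RingOfIntegers X.E))
    (L₀ : Submodule (RingOfIntegers X.E) (Fin 3 → X.E)) (xm : X.Tuple) (ℓ : X.LocS D p L₀ xm)
    (S' : Set X.LineTuple) : Prop :=
  ∀ (N : ℕ) (w : X.LineTuple), X.coefQ D.cf (ℓ.loc N) (X.rep w) ≠ 0 → w ∈ S'

/-- The off-main line tuples of `S'` (as a subtype of the off-main line tuples) are the off-main part of `S'`. -/
def offMainSubtypeEquiv (S' : Set X.LineTuple) (xm : X.Tuple) :
    {w : {w : X.LineTuple // X.orbitOf w ≠ X.orbitOf (X.lines xm)} // w.1 ∈ S'} ≃ X.invSet S' xm :=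
  (Equiv.subtypeSubtypeEquivSubtypeInter (fun w => X.orbitOf w ≠ X.orbitOf (X.lines xm)) (fun w => w ∈ S')).trans
    (Equiv.subtypeEquivRight fun w => by
      show _ ↔ w ∈ X.invSet S' xm
      unfold invSet
      rw [Set.mem_setOf_eq, and_comm])

/-- The sum of a function over the off-main tuples of `S'` equals its `S'`-indicator summed over all off-main
tuples. -/
theorem tsum_invSet_eq (S' : Set X.LineTuple) (xm : X.Tuple) (f : X.LineTuple → ℝ≥0∞) :
    ∑' v : X.invSet S' xm, f v.1 =
      ∑' w : {w : X.LineTuple // X.orbitOf w ≠ X.orbitOf (X.lines xm)}, S'.indicator f w.1 := by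
  rw [← (X.offMainSubtypeEquiv S' xm).tsum_eq]
  have h : ∀ w : {w : X.LineTuple // X.orbitOf w ≠ X.orbitOf (X.lines xm)},
      S'.indicator f w.1 = ({w : {w : X.LineTuple // X.orbitOf w ≠ X.orbitOf (X.lines xm)} | w.1 ∈ S'}).indicator
        (fun w => f w.1) w := by
    intro w
    by_cases hw : w.1 ∈ S'
    · rw [Set.indicator_of_mem hw, Set.indicator_of_mem (show w ∈ {w : {w : X.LineTuple //
        X.orbitOf w ≠ X.orbitOf (X.lines xm)} | w.1 ∈ S'} from hw)]
    · rw [Set.indicator_of_notMem hw, Set.indicator_of_notMem (show w ∉ {w : {w : X.LineTuple //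
        X.orbitOf w ≠ X.orbitOf (X.lines xm)} | w.1 ∈ S'} from hw)]
  simp only [h]
  rw [← tsum_subtype]
  rfl

/-- **THE POINTWISE BOUND**: under the invariant growth clause and for `S'` containing the support, the off-main
density of the depth-`N` localiser is at most `K q₂^N e^{−κ q^{N/d}}` times the invariant majorant density, on the
whole ball. -/
theorem offMainDensity_le_invMajorantDensity (D : X.ThetaData)
    (p : IsDedekindDomain.HeightOneSpectrum (RingOfIntegers X.E))
    (L₀ : Submodule (RingOfIntegers X.E) (Fin 3 → X.E)) (xm : X.Tuple)
    (h02 : xm 2 = xm 0) (h13 : xm 3 = xm 1) (hab : LinearIndependent X.E ![xm 0, xm 1]) (ℓ : X.LocS D p L₀ xm)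
    (hinv : X.GrowthInv D p L₀ xm ℓ) {S' : Set X.LineTuple} (hsupp : X.SupportIn D p L₀ xm ℓ S') :
    ∃ (K q₂ κ e c₁ : ℝ), 0 < κ ∧ 0 ≤ K ∧ 0 ≤ q₂ ∧ 0 < c₁ ∧ ∀ (N : ℕ), ∀ z ∈ ball,
      X.offMainDensity D (ℓ.loc N) xm z ≤
        ENNReal.ofReal (K * q₂ ^ N * X.offMainDecay p κ N) * X.invMajorantDensity D S' xm e c₁ z := by
  obtain ⟨B, q₂, e, κ, C₁, c₁, hκ, hB, hq₂, hC₁, hc₁, hclass⟩ :=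
    X.summand_bound_off_main_inv D p L₀ xm h02 h13 hab ℓ hinv
  refine ⟨B * C₁, q₂, κ, e, c₁, hκ, mul_nonneg hB hC₁, hq₂, hc₁, fun N z hz => ?_⟩
  have hdec0 : 0 ≤ X.offMainDecay p κ N := X.offMainDecay_nonneg p κ N
  -- the termwise bound, with the `S'`-indicator
  have hterm : ∀ w : {w : X.LineTuple // X.orbitOf w ≠ X.orbitOf (X.lines xm)},
      ‖X.summand D.Φ D.cf (ℓ.loc N) w.1 z‖ₑ ≤ ENNReal.ofReal (B * C₁ * q₂ ^ N * X.offMainDecay p κ N) *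
        S'.indicator (fun v => ENNReal.ofReal (X.invMajorant D e c₁ v z)) w.1 := by
    intro w
    by_cases hc : X.coefQ D.cf (ℓ.loc N) (X.rep w.1) = 0
    · unfold summand
      rw [hc, zero_mul, enorm_zero]
      exact zero_le
    · have hw : w.1 ∈ S' := hsupp N w.1 hc
      rw [Set.indicator_of_mem hw, ← ofReal_norm, ← ENNReal.ofReal_mul (by positivity)]
      refine ENNReal.ofReal_le_ofReal ?_
      have h := hclass N w.1 z hz w.2
      unfold offMainDecay
      calc ‖X.summand D.Φ D.cf (ℓ.loc N) w.1 z‖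
          ≤ B * q₂ ^ N * X.invMajorant D e c₁ w.1 z *
            (C₁ * Real.exp (-(κ * (((Ideal.absNorm p.asIdeal : ℝ) ^ N) ^ ((Module.finrank ℚ X.E : ℝ)⁻¹))))) := h
        _ = B * C₁ * q₂ ^ N * Real.exp (-(κ * (((Ideal.absNorm p.asIdeal : ℝ) ^ N) ^
              ((Module.finrank ℚ X.E : ℝ)⁻¹)))) * X.invMajorant D e c₁ w.1 z := by ring
  calc X.offMainDensity D (ℓ.loc N) xm z
      = ∑' w : {w : X.LineTuple // X.orbitOf w ≠ X.orbitOf (X.lines xm)},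
          ‖X.summand D.Φ D.cf (ℓ.loc N) w.1 z‖ₑ := rfl
    _ ≤ ∑' w : {w : X.LineTuple // X.orbitOf w ≠ X.orbitOf (X.lines xm)},
          ENNReal.ofReal (B * C₁ * q₂ ^ N * X.offMainDecay p κ N) *
            S'.indicator (fun v => ENNReal.ofReal (X.invMajorant D e c₁ v z)) w.1 := ENNReal.tsum_le_tsum hterm
    _ = ENNReal.ofReal (B * C₁ * q₂ ^ N * X.offMainDecay p κ N) *
          ∑' w : {w : X.LineTuple // X.orbitOf w ≠ X.orbitOf (X.lines xm)},
            S'.indicator (fun v => ENNReal.ofReal (X.invMajorant D e c₁ v z)) w.1 := ENNReal.tsum_mul_left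
    _ = ENNReal.ofReal (B * C₁ * q₂ ^ N * X.offMainDecay p κ N) * X.invMajorantDensity D S' xm e c₁ z := by
        unfold invMajorantDensity
        rw [X.tsum_invSet_eq S' xm (fun v => ENNReal.ofReal (X.invMajorant D e c₁ v z))]

/-- **`OffMainMass` FROM THE INVARIANT ROUTE**: the invariant growth clause, a `Γ`-stable set containing the support, a
fundamental domain `F` of `Γ`, and the finite mass of the invariant majorant density over `F` give the residual of
L3.5. -/
theorem offMainMass_of_growthInv (D : X.ThetaData)
    (p : IsDedekindDomain.HeightOneSpectrum (RingOfIntegers X.E))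
    (L₀ : Submodule (RingOfIntegers X.E) (Fin 3 → X.E)) (xm : X.Tuple)
    (h02 : xm 2 = xm 0) (h13 : xm 3 = xm 1) (hab : LinearIndependent X.E ![xm 0, xm 1]) (ℓ : X.LocS D p L₀ xm)
    (hinv : X.GrowthInv D p L₀ xm ℓ) {S' : Set X.LineTuple} (hS : X.IsGammaStable S')
    (hsupp : X.SupportIn D p L₀ xm ℓ S') {F : Set (Fin 2 → ℂ)}
    (hF : IsFundamentalDomainFor (ballActions X.τ₀ X.C X.Γ) F)
    (hmass : ∀ e c₁ : ℝ, 0 < c₁ → ∃ M_F : ℝ, 0 ≤ M_F ∧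
      ∫⁻ z in F, X.invMajorantDensity D S' xm e c₁ z ≤ ENNReal.ofReal M_F) :
    Nonempty (X.OffMainMass D p L₀ xm ℓ) := by
  obtain ⟨K, q₂, κ, e, c₁, hκ, hK, hq₂, hc₁, hpt⟩ :=
    X.offMainDensity_le_invMajorantDensity D p L₀ xm h02 h13 hab ℓ hinv hsupp
  obtain ⟨M_F, hMF, hμF⟩ := hmass e c₁ hc₁
  exact X.offMainMass_of_invariantMajorant D p L₀ xm ℓ hF (X.invMajorantDensity D S' xm e c₁)
    (X.invMajorantDensity_isInvariant D hS xm e c₁) hMF hμF hK hq₂ hκ hpt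

/-- **L3.5 THROUGH THE INVARIANT ROUTE**: `term_dominated`'s conclusion verbatim from the same hypotheses. -/
theorem term_dominated_of_growthInv (D : X.ThetaData)
    (p : IsDedekindDomain.HeightOneSpectrum (RingOfIntegers X.E))
    (L₀ : Submodule (RingOfIntegers X.E) (Fin 3 → X.E)) (xm : X.Tuple)
    (h02 : xm 2 = xm 0) (h13 : xm 3 = xm 1) (hab : LinearIndependent X.E ![xm 0, xm 1]) (ℓ : X.LocS D p L₀ xm)
    (hinv : X.GrowthInv D p L₀ xm ℓ) {S' : Set X.LineTuple} (hS : X.IsGammaStable S')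
    (hsupp : X.SupportIn D p L₀ xm ℓ S') {F : Set (Fin 2 → ℂ)}
    (hF : IsFundamentalDomainFor (ballActions X.τ₀ X.C X.Γ) F)
    (hmass : ∀ e c₁ : ℝ, 0 < c₁ → ∃ M_F : ℝ, 0 ≤ M_F ∧
      ∫⁻ z in F, X.invMajorantDensity D S' xm e c₁ z ≤ ENNReal.ofReal M_F) :
    ∃ bound : X.Orbit → ℝ, (∀ o, 0 ≤ bound o) ∧ Summable bound ∧
      ∀ N (o : X.Orbit), o ≠ X.orbitOf (X.lines xm) →
        ‖X.term D.Φ D.cf (ℓ.level N) (ℓ.loc N) o‖ ≤ bound o := by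
  obtain ⟨H⟩ := X.offMainMass_of_growthInv D p L₀ xm h02 h13 hab ℓ hinv hS hsupp hF hmass
  exact X.term_dominated_of_offMainMass D ℓ H

end T4Data

end Summit.Ventures.HodgeRepro.Tier4.Line3

end
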